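import Summits.KontsevichZagierPeriods.KontsevichZagierPeriods.Theorems.FermatIsogenyDeepWordSectorP04

/-! # The LEVEL-`N` bridge: `BetaWordSectorLevel k N → BetaWordSectorAt k N` (unreduced exponents in `(1/N)ℤ_{>0}`)

decomp-kz census-1 g10 (landing seat), executing critic g7 l.1416 / writer l.1418 (Q5): «add the ≤ 80-line bridge
`prodRung_of_level (N)` and close `Ladder.ProdRung 3 / 4` (and `6` modulo `h6`) BY NAME».  The node (lens-5 g21/g22,
`…DeepWordSectorP01–P09`) proves `BetaWordSector k ↔ ∀ N > 0, BetaWordSectorLevel k N` through the reduction to the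
fundamental domain `(0,1]` with the COMMON denominator of all exponents; the ladder's rungs `ProdRung N` quantify over
UNREDUCED exponents `m/N > 0` at a FIXED level `N`.  Since `red (m/N) = m'/N` stays at level `N`, the proof of
`betaWordSector_of_reduced` runs at the fixed level: this file is that proof with the level threaded through
(`betaWordSectorAt_of_level`), plus the two-letter unfolding `prodRungAt_of_level` in the VERBATIM binder shape of
`Cruxes/BetaProductSector/Ladder.lean`'s `ProdRung N`.  --supports stmt-KontsevichZagierPeriods-3898. -/

noncomputable section

namespace Summit.KontsevichZagierPeriods.FermatIsogeny.DeepTargets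

open Literature.NumberTheory.Transcendental MeasureTheory

/-- **Level-`N` Beta-word sector, unreduced**: `BetaWordSector k` restricted to exponent vectors with ALL entries in
`(1/N)ℤ_{>0}` (no upper bound) — the `k`-letter analogue of the ladder rung `Ladder.ProdRung N` (`k = 2`). (cite KontsevichZagier2001, §1.2 Conjecture 1) -/
def BetaWordSectorAt (k N : ℕ) : Prop :=
  ∀ (a b a' b' : Fin k → ℚ) (q : ℝ), (∀ i, 0 < a i) → (∀ i, 0 < b i) → (∀ i, 0 < a' i) → (∀ i, 0 < b' i) →
    (∀ i, ∃ m : ℤ, a i = m / N) → (∀ i, ∃ m : ℤ, b i = m / N) → (∀ i, ∃ m : ℤ, a' i = m / N) →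
    (∀ i, ∃ m : ℤ, b' i = m / N) →
    IsAlgebraic ℚ q → ∀ (r r' : KZ.IntegralRep k), r.domain = {x | ∀ i, x i ∈ Set.Ioo (0:ℝ) 1} →
    Set.EqOn r.integrand (fun x => ∏ i, (x i) ^ ((a i : ℝ) - 1) * (1 - x i) ^ ((b i : ℝ) - 1)) r.domain →
    r'.domain = {x | ∀ i, x i ∈ Set.Ioo (0:ℝ) 1} →
    Set.EqOn r'.integrand (fun x => q * ∏ i, (x i) ^ ((a' i : ℝ) - 1) * (1 - x i) ^ ((b' i : ℝ) - 1)) r'.domain →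
    r.value = r'.value → KZ.Equivalent r r'

/-- The whole sector is the conjunction of its unreduced level-`N` sectors (every positive rational is `m/N` for `N` its
denominator). [bookkeeping] -/
theorem betaWordSectorAt_of_betaWordSector {k N : ℕ} (h : BetaWordSector k) : BetaWordSectorAt k N :=
  fun a b a' b' q ha hb ha' hb' _ _ _ _ hq => h a b a' b' q ha hb ha' hb' hq

/-- `red` preserves the level: if `a = m/N` then `(red a).den ∣ N` (`red a = a − (⌈a⌉ − 1)` differs from `a` by an integer). [bookkeeping] -/
theorem den_red_dvd {a : ℚ} {N : ℕ} (hN : 0 < N) (h : ∃ m : ℤ, a = m / N) : (red a).den ∣ N := by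
  obtain ⟨m, rfl⟩ := h
  have hN' : (N : ℚ) ≠ 0 := by exact_mod_cast hN.ne'
  have e : red ((m : ℚ) / N) = ((m - (⌈(m : ℚ) / N⌉ - 1) * N : ℤ) : ℚ) / N := by
    unfold red
    push_cast
    rw [sub_div, mul_div_cancel_right₀ _ hN']
  have hd := Rat.den_dvd (m - (⌈(m : ℚ) / N⌉ - 1) * N) (N : ℤ)
  rw [Rat.divInt_eq_div] at hd
  push_cast at hd
  rw [e]
  exact_mod_cast hd

/-- **THE BRIDGE at a fixed level**: the finite `(k, N)` box implies the unreduced level-`N` sector.  Proof = the node's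
`betaWordSector_of_reduced` (reduction of every letter to `(0,1]` by the PROVED reflection/translation moves, constants
collected in `κ`), observing that the reduced exponents stay at level `N` (`den_red_dvd`, `exists_lvl_eq` with `N` itself). -/
theorem betaWordSectorAt_of_level {k N : ℕ} (hN : 0 < N) (h : BetaWordSectorLevel k N) : BetaWordSectorAt k N := by
  intro a b a' b' q ha hb ha' hb' hNa hNb hNa' hNb' hq r r' hr hi hr' hi' hv
  have hR : BetaReflectionMove := betaReflectionMove_holds
  have hT : BetaTranslationMove := betaTranslationMove_holds
  have hab : ∀ j, 0 < a j ∧ 0 < b j := fun j => ⟨ha j, hb j⟩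
  have hab' : ∀ j, 0 < a' j ∧ 0 < b' j := fun j => ⟨ha' j, hb' j⟩
  have hxy : ∀ j, 0 < red (a j) ∧ 0 < red (b j) := fun j => ⟨red_pos _, red_pos _⟩
  have hxy' : ∀ j, 0 < red (a' j) ∧ 0 < red (b' j) := fun j => ⟨red_pos _, red_pos _⟩
  obtain ⟨C, hC, hC0, eC⟩ := word_reduce hR hT a b hab
  obtain ⟨C', hC', hC'0, eC'⟩ := word_reduce hR hT a' b' hab'
  obtain ⟨R, hRd, hRi⟩ := KZ.exists_cubeBetaRep (fun j => red (a j)) (fun j => red (b j)) hxy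
  obtain ⟨R', hR'd, hR'i⟩ := KZ.exists_cubeBetaRep (fun j => red (a' j)) (fun j => red (b' j)) hxy'
  have hq' : IsAlgebraic ℚ (q * C' * C⁻¹) := (hq.mul hC').mul hC.inv
  have er : KZ.toFormalPeriod (KZ.of r) = kc C hC * ∏ j, bcl (red (a j)) (red (b j)) := by
    rw [word_class a b hab r hr hi, eC]
  have er' : KZ.toFormalPeriod (KZ.of r') = kc q hq * (kc C' hC' * ∏ j, bcl (red (a' j)) (red (b' j))) := by
    rw [word_class_const q hq a' b' hab' r' hr' hi', eC']
  have eR : KZ.toFormalPeriod (KZ.of R) = ∏ j, bcl (red (a j)) (red (b j)) := word_class _ _ hxy R hRd hRi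
  have eR' : KZ.toFormalPeriod (KZ.of R') = ∏ j, bcl (red (a' j)) (red (b' j)) := word_class _ _ hxy' R' hR'd hR'i
  have hR''i : Set.EqOn (R'.constMul (q * C' * C⁻¹) hq').integrand
      (fun x => (q * C' * C⁻¹) * ∏ i, (x i) ^ ((red (a' i) : ℝ) - 1) * (1 - x i) ^ ((red (b' i) : ℝ) - 1))
      (R'.constMul (q * C' * C⁻¹) hq').domain := fun z hz => by
    show (q * C' * C⁻¹) * R'.integrand z = _
    rw [hR'i hz]
  have eR'' : KZ.toFormalPeriod (KZ.of (R'.constMul (q * C' * C⁻¹) hq')) =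
      kc (q * C' * C⁻¹) hq' * ∏ j, bcl (red (a' j)) (red (b' j)) :=
    word_class_const _ hq' _ _ hxy' _ hR'd hR''i
  have vr : r.value = C * R.value := by
    have h1 := congrArg KZ.evalP er
    rw [← eR, map_mul, evalP_kc, KZ.evalP_toFormalPeriod_of, KZ.evalP_toFormalPeriod_of] at h1
    exact h1
  have vr' : r'.value = q * (C' * R'.value) := by
    have h1 := congrArg KZ.evalP er'
    rw [← eR', map_mul, map_mul, evalP_kc, evalP_kc, KZ.evalP_toFormalPeriod_of, KZ.evalP_toFormalPeriod_of] at h1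
    exact h1
  have hvR : R.value = (R'.constMul (q * C' * C⁻¹) hq').value := by
    rw [KZ.IntegralRep.value_constMul]
    have hC1 : C ≠ 0 := hC0.ne'
    apply mul_left_cancel₀ hC1
    rw [← vr, hv, vr']
    field_simp
  -- the reduced exponents are at level N: realise them as lvl N u
  have hra : ∀ i, 0 < red (a i) ∧ red (a i) ≤ 1 := fun i => ⟨red_pos _, red_le_one _⟩
  have hrb : ∀ i, 0 < red (b i) ∧ red (b i) ≤ 1 := fun i => ⟨red_pos _, red_le_one _⟩
  have hra' : ∀ i, 0 < red (a' i) ∧ red (a' i) ≤ 1 := fun i => ⟨red_pos _, red_le_one _⟩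
  have hrb' : ∀ i, 0 < red (b' i) ∧ red (b' i) ≤ 1 := fun i => ⟨red_pos _, red_le_one _⟩
  obtain ⟨u, hu⟩ := exists_lvl_eq hN (fun i => red (a i)) hra (fun i => den_red_dvd hN (hNa i))
  obtain ⟨v, hv'⟩ := exists_lvl_eq hN (fun i => red (b i)) hrb (fun i => den_red_dvd hN (hNb i))
  obtain ⟨u', hu'⟩ := exists_lvl_eq hN (fun i => red (a' i)) hra' (fun i => den_red_dvd hN (hNa' i))
  obtain ⟨v', hv''⟩ := exists_lvl_eq hN (fun i => red (b' i)) hrb' (fun i => den_red_dvd hN (hNb' i))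
  have eu : ∀ i, red (a i) = lvl N u i := fun i => congrFun hu i
  have ev : ∀ i, red (b i) = lvl N v i := fun i => congrFun hv' i
  have eu' : ∀ i, red (a' i) = lvl N u' i := fun i => congrFun hu' i
  have ev' : ∀ i, red (b' i) = lvl N v' i := fun i => congrFun hv'' i
  have hRi2 : Set.EqOn R.integrand
      (fun x => ∏ i, (x i) ^ ((lvl N u i : ℝ) - 1) * (1 - x i) ^ ((lvl N v i : ℝ) - 1)) R.domain := by
    intro x hx; rw [hRi hx]; simp only [eu, ev]
  have hR''i2 : Set.EqOn (R'.constMul (q * C' * C⁻¹) hq').integrand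
      (fun x => (q * C' * C⁻¹) * ∏ i, (x i) ^ ((lvl N u' i : ℝ) - 1) * (1 - x i) ^ ((lvl N v' i : ℝ) - 1))
      (R'.constMul (q * C' * C⁻¹) hq').domain := by
    intro x hx; rw [hR''i hx]; simp only [eu', ev']
  -- the box
  have H : KZ.Equivalent R (R'.constMul (q * C' * C⁻¹) hq') := h u v u' v' (q * C' * C⁻¹) hq' R _ hRd hRi2 hR'd hR''i2 hvR
  have eRR := H.toFormalPeriod_eq
  rw [eR, eR''] at eRR
  have hC1 : C ≠ 0 := hC0.ne'
  have hcc : C * (q * C' * C⁻¹) = q * C' := by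
    rw [mul_comm C (q * C' * C⁻¹), mul_assoc (q * C') C⁻¹ C, inv_mul_cancel₀ hC1, mul_one]
  have e : KZ.toFormalPeriod (KZ.of r) = KZ.toFormalPeriod (KZ.of r') := by
    rw [er, er', eRR, ← mul_assoc (kc C hC), ← kc_mul C (q * C' * C⁻¹) hC hq', ← mul_assoc (kc q hq),
      ← kc_mul q C' hq hC', kc_congr (hC.mul hq') (hq.mul hC') hcc]
  show KZ.of r - KZ.of r' ∈ KZ.relations
  exact KZ.toFormalPeriod_eq_iff.mp e

/-- **`ProdRung N` at a fixed level, in the ladder's VERBATIM binder shape** (`Cruxes/BetaProductSector/Ladder.lean`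
`ProdRung N` = crux 3898 with the eight exponents in `(1/N)ℤ`): it follows from the finite `(2, N)` box. -/
theorem prodRungAt_of_level {N : ℕ} (hN : 0 < N) (h : BetaWordSectorLevel 2 N) :
    ∀ (a b e d a' b' e' d' : ℚ) (q : ℝ), 0 < a → 0 < b → 0 < e → 0 < d → 0 < a' → 0 < b' → 0 < e' → 0 < d' →
    IsAlgebraic ℚ q →
    (∃ m : ℤ, a = m / N) → (∃ m : ℤ, b = m / N) → (∃ m : ℤ, e = m / N) → (∃ m : ℤ, d = m / N) →
    (∃ m : ℤ, a' = m / N) → (∃ m : ℤ, b' = m / N) → (∃ m : ℤ, e' = m / N) → (∃ m : ℤ, d' = m / N) →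
    ∀ (r r' : KZ.IntegralRep 2), r.domain = {x | ∀ i, x i ∈ Set.Ioo (0:ℝ) 1} →
    Set.EqOn r.integrand (fun x => (x 0) ^ ((a:ℝ) - 1) * (1 - x 0) ^ ((b:ℝ) - 1) * (x 1) ^ ((e:ℝ) - 1) *
      (1 - x 1) ^ ((d:ℝ) - 1)) r.domain →
    r'.domain = {x | ∀ i, x i ∈ Set.Ioo (0:ℝ) 1} →
    Set.EqOn r'.integrand (fun x => q * (x 0) ^ ((a':ℝ) - 1) * (1 - x 0) ^ ((b':ℝ) - 1) * (x 1) ^ ((e':ℝ) - 1) *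
      (1 - x 1) ^ ((d':ℝ) - 1)) r'.domain →
    r.value = r'.value → KZ.Equivalent r r' := by
  intro a b e d a' b' e' d' q ha hb he hd ha' hb' he' hd' hq hNa hNb hNe hNd hNa' hNb' hNe' hNd' r r' hr hi hr' hi' hv
  have hA := betaWordSectorAt_of_level hN h
  refine hA ![a, e] ![b, d] ![a', e'] ![b', d'] q ?_ ?_ ?_ ?_ ?_ ?_ ?_ ?_ hq r r' hr ?_ hr' ?_ hv
  · intro i
    fin_cases i
    · simpa using ha
    · simpa using he
  · intro i
    fin_cases i
    · simpa using hb
    · simpa using hd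
  · intro i
    fin_cases i
    · simpa using ha'
    · simpa using he'
  · intro i
    fin_cases i
    · simpa using hb'
    · simpa using hd'
  · intro i
    fin_cases i
    · simpa using hNa
    · simpa using hNe
  · intro i
    fin_cases i
    · simpa using hNb
    · simpa using hNd
  · intro i
    fin_cases i
    · simpa using hNa'
    · simpa using hNe'
  · intro i
    fin_cases i
    · simpa using hNb'
    · simpa using hNd'
  · intro x hx
    rw [hi hx]
    simp only [Fin.prod_univ_two, Fin.isValue, Matrix.cons_val_zero, Matrix.cons_val_one]
    ring
  · intro x hx
    rw [hi' hx]
    simp only [Fin.prod_univ_two, Fin.isValue, Matrix.cons_val_zero, Matrix.cons_val_one]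
    ring

end Summit.KontsevichZagierPeriods.FermatIsogeny.DeepTargets

end
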